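import Mathlib
import HarnessLib
import Literature.MathematicalPhysics.QuantumLattice.GaugeGroups
import Literature.MathematicalPhysics.QuantumFieldTheory.ConstructiveQFTWave0
import Summits.Ventures.LatticeQCDFlow.Scaling.SU2Haar

/-!
# Two-sided volume of the cone over a spherical cap of `S³` (pub-lqcd THEORY-2 v2.3, #21c)

HONEST FRAMING: exact (Metropolis-corrected) sampling algorithms for lattice gauge theory;
figures of merit are autocorrelation/cost numbers at stated couplings and volumes;
no continuum-physics claim.

Elementary Lebesgue-measure geometry in `ℝ⁴ = EuclideanSpace ℝ (Fin 4)` for the cone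
`capCone r = Ioo 0 1 • cap r` over the cap `cap r = {y ∈ S³ : 2 - 2y₀ ≤ r²}` of #21b:

* `volume_capCone_le`: `vol(capCone r) ≤ 16·r³` for `r ≥ 0` — the cone lies in the box
  `[-1, 1] × [-r, r]³` (a point `t·y` of the cone has `|t·yᵢ|² ≤ yᵢ² ≤ 1 - y₀² ≤ r²`, `i ≠ 0`);
* `le_volume_capCone`: `r³/32 ≤ vol(capCone r)` for `0 < r ≤ 1` — the cone contains the box
  `[1/2, 3/4] × [-r/4, r/4]³` (for such `x`, `‖x‖ < 1` and `2 - 2x₀/‖x‖ ≤ r²`).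

With `haarProbability_actionBall` (#21b) these give the Haar small-ball law for `SU(2)` (#21d).
-/

noncomputable section

open MeasureTheory Measure Set Metric
open scoped Pointwise ENNReal

namespace Summit.Ventures.LatticeQCDFlow.Theory2.Lattice.SU2

/-- The cone (radii in `(0, 1)`) over the cap `cap r`. -/
def capCone (r : ℝ) : Set R4 := Ioo (0 : ℝ) 1 • (((↑) : sphere (0 : R4) 1 → R4) '' cap r)

/-- A coordinate box of `ℝ⁴`. -/
def box (a b : Fin 4 → ℝ) : Set R4 := {x | ∀ i, a i ≤ x i ∧ x i ≤ b i}

/-- The box is the preimage of a product interval under `ofLp`. -/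
theorem box_eq (a b : Fin 4 → ℝ) : box a b = (WithLp.ofLp : R4 → Fin 4 → ℝ) ⁻¹' Icc a b := by
  ext x
  simp only [box, Set.mem_setOf_eq, Set.mem_preimage, Set.mem_Icc, Pi.le_def, forall_and]

/-- Lebesgue volume of a coordinate box: `∏ (bᵢ - aᵢ)`. -/
theorem volume_box {a b : Fin 4 → ℝ} (h : a ≤ b) :
    volume (box a b) = ENNReal.ofReal (∏ i, (b i - a i)) := by
  rw [box_eq, (PiLp.volume_preserving_ofLp (Fin 4)).measure_preimage
    measurableSet_Icc.nullMeasurableSet, Real.volume_Icc_pi,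
    ENNReal.ofReal_prod_of_nonneg fun i _ => sub_nonneg.mpr (h i)]

/-- The unit-sphere identity in coordinates: `Σ yᵢ² = 1`. -/
theorem sum_sq_eq_one (y : sphere (0 : R4) 1) :
    (y : R4) 0 ^ 2 + (y : R4) 1 ^ 2 + (y : R4) 2 ^ 2 + (y : R4) 3 ^ 2 = 1 := by
  have h := EuclideanSpace.real_norm_sq_eq (y : R4)
  have hy : ‖(y : R4)‖ = 1 := by simp
  rw [hy, Fin.sum_univ_four] at h
  linarith

/-- UPPER BOUND: the cone over the cap lies in the box `[-1, 1] × [-r, r]³`. -/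
theorem capCone_subset_box {r : ℝ} (hr : 0 ≤ r) :
    capCone r ⊆ box ![-1, -r, -r, -r] ![1, r, r, r] := by
  intro x hx
  obtain ⟨t, ht, _, ⟨y, hy, rfl⟩, rfl⟩ := Set.mem_smul.mp hx
  have hs := sum_sq_eq_one y
  have hcap : 2 - 2 * (y : R4) 0 ≤ r ^ 2 := hy
  have h0' : -1 ≤ (y : R4) 0 ∧ (y : R4) 0 ≤ 1 := abs_le_of_sq_le_sq' (by nlinarith) zero_le_one
  have hrest : (y : R4) 1 ^ 2 + (y : R4) 2 ^ 2 + (y : R4) 3 ^ 2 ≤ r ^ 2 := by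
    nlinarith [h0'.1, h0'.2]
  have ht2 : t ^ 2 ≤ 1 := by nlinarith [ht.1, ht.2]
  have hc : ∀ c : ℝ, c ^ 2 ≤ r ^ 2 → -r ≤ t * c ∧ t * c ≤ r := fun c hc =>
    abs_le_of_sq_le_sq' (by nlinarith [sq_nonneg c]) hr
  have hc0 : -1 ≤ t * (y : R4) 0 ∧ t * (y : R4) 0 ≤ 1 :=
    abs_le_of_sq_le_sq' (by nlinarith [sq_nonneg ((y : R4) 0)]) zero_le_one
  have hc1 := hc ((y : R4) 1) (by nlinarith [sq_nonneg ((y : R4) 2), sq_nonneg ((y : R4) 3)])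
  have hc2 := hc ((y : R4) 2) (by nlinarith [sq_nonneg ((y : R4) 1), sq_nonneg ((y : R4) 3)])
  have hc3 := hc ((y : R4) 3) (by nlinarith [sq_nonneg ((y : R4) 1), sq_nonneg ((y : R4) 2)])
  intro i
  fin_cases i <;> simp [hc0, hc1, hc2, hc3]

/-- `vol(capCone r) ≤ 16·r³` for `r ≥ 0`. -/
theorem volume_capCone_le {r : ℝ} (hr : 0 ≤ r) :
    volume (capCone r) ≤ ENNReal.ofReal (16 * r ^ 3) := by
  refine (measure_mono (capCone_subset_box hr)).trans ?_
  rw [volume_box]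
  · apply le_of_eq
    congr 1
    simp [Fin.prod_univ_four]
    ring
  · intro i
    fin_cases i <;> simp <;> linarith

/-- LOWER BOUND: the box `[1/2, 3/4] × [-r/4, r/4]³` lies in the cone over the cap
(`0 < r ≤ 1`). -/
theorem box_subset_capCone {r : ℝ} (hr : 0 < r) (hr1 : r ≤ 1) :
    box ![1 / 2, -(r / 4), -(r / 4), -(r / 4)] ![3 / 4, r / 4, r / 4, r / 4] ⊆ capCone r := by
  intro x hx
  have h0 := hx 0
  have h1 := hx 1
  have h2 := hx 2
  have h3 := hx 3
  simp only [Matrix.cons_val_zero, Matrix.cons_val_one, Matrix.cons_val] at h0 h1 h2 h3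
  set n := ‖x‖ with hn
  have hn2 : n ^ 2 = x 0 ^ 2 + x 1 ^ 2 + x 2 ^ 2 + x 3 ^ 2 := by
    rw [hn, EuclideanSpace.real_norm_sq_eq, Fin.sum_univ_four]
  have hnn : 0 ≤ n := norm_nonneg _
  have hsq1 : x 1 ^ 2 ≤ (r / 4) ^ 2 := by nlinarith [h1.1, h1.2]
  have hsq2 : x 2 ^ 2 ≤ (r / 4) ^ 2 := by nlinarith [h2.1, h2.2]
  have hsq3 : x 3 ^ 2 ≤ (r / 4) ^ 2 := by nlinarith [h3.1, h3.2]
  have hn2le : n ^ 2 ≤ x 0 ^ 2 + 3 * (r / 4) ^ 2 := by rw [hn2]; linarith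
  have hn0 : 0 < n := by nlinarith [h0.1]
  have hn1 : n < 1 := by nlinarith [h0.2]
  have hx0 : 0 ≤ x 0 := by linarith [h0.1]
  -- the cap condition `n (2 - r²) ≤ 2 x₀`
  have hkey : (n * (2 - r ^ 2)) ^ 2 ≤ (2 * x 0) ^ 2 := by
    have hr2 : r ^ 2 ≤ 1 := by nlinarith
    have hr4 : r ^ 4 ≤ r ^ 2 := by nlinarith
    have hA : (2 - r ^ 2) ^ 2 ≤ 4 - 3 * r ^ 2 := by nlinarith
    have hB : 0 ≤ (2 - r ^ 2) ^ 2 := sq_nonneg _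
    calc (n * (2 - r ^ 2)) ^ 2 = n ^ 2 * (2 - r ^ 2) ^ 2 := by ring
      _ ≤ (x 0 ^ 2 + 3 * (r / 4) ^ 2) * (2 - r ^ 2) ^ 2 :=
          mul_le_mul_of_nonneg_right hn2le hB
      _ ≤ (x 0 ^ 2 + 3 * (r / 4) ^ 2) * (4 - 3 * r ^ 2) :=
          mul_le_mul_of_nonneg_left hA (by positivity)
      _ ≤ (2 * x 0) ^ 2 := by
          have hx4 : 0 ≤ x 0 ^ 2 - 1 / 4 := by nlinarith [h0.1]
          nlinarith [mul_nonneg (sq_nonneg r) hx4, sq_nonneg (r ^ 2)]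
  have hkey' : n * (2 - r ^ 2) ≤ 2 * x 0 := by
    exact (abs_le_of_sq_le_sq' hkey (by linarith)).2
  have hxne : x ≠ 0 := by
    intro h; rw [h, norm_zero] at hn; linarith
  refine Set.mem_smul.mpr ⟨n, ⟨hn0, hn1⟩, n⁻¹ • x, ⟨⟨n⁻¹ • x, ?_⟩, ?_, rfl⟩, ?_⟩
  · simp [norm_smul, hn, hxne]
  · show 2 - 2 * ((n⁻¹ • x : R4) 0) ≤ r ^ 2
    have h' : (n⁻¹ • x : R4) 0 = x 0 / n := by
      simp [div_eq_inv_mul]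
    rw [h']
    have : 2 - r ^ 2 ≤ 2 * (x 0 / n) := by
      rw [mul_div_assoc', le_div_iff₀ hn0]
      linarith
    linarith
  · rw [smul_inv_smul₀ hn0.ne']

/-- `r³/32 ≤ vol(capCone r)` for `0 < r ≤ 1`. -/
theorem le_volume_capCone {r : ℝ} (hr : 0 < r) (hr1 : r ≤ 1) :
    ENNReal.ofReal (r ^ 3 / 32) ≤ volume (capCone r) := by
  refine le_trans (le_of_eq ?_) (measure_mono (box_subset_capCone hr hr1))
  rw [volume_box]
  · congr 1
    simp [Fin.prod_univ_four]
    ring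
  · intro i
    fin_cases i <;> simp <;> linarith

/-- The unit ball of `ℝ⁴` has positive finite volume (as a real number). -/
theorem volume_ball_toReal_pos : 0 < (volume (ball (0 : R4) 1)).toReal :=
  ENNReal.toReal_pos (measure_ball_pos volume (0 : R4) one_pos).ne' measure_ball_lt_top.ne

end Summit.Ventures.LatticeQCDFlow.Theory2.Lattice.SU2

end
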